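import Summits.PneNP.PneNP.Theorems.ConvexRankGatesCliqueExtLowerBoundSandwichHelpers
import Summits.PneNP.PneNP.Theorems.CliqueExtLowerBound.Negative.AnchoredThetaCounting

/-!
# The dual horn: a sandwichable gate is one-sidedly blind on the referee pair
(crux `CliqueExtLowerBound`, stmt-PneNP-10682; line `width-threshold-certificate-sparsity`, lead c10)

The three open leaves of skeleton r7 (`stub_permCnf`, `stub_grankCnf`, `stub_convWideCnf`) ask, for a
wide gate `φ` composed with `s`-local monotone CNFs `C` of the edges, for ONE legal local pair
`dnf ≤ cnf` (monomials of `< r` slots, clauses of `< s` slots) losing at most `ε·#P` of the positives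
accepted by `g = φ ∘ cval C` and accepting at most `ε·#N` of the negatives rejected by `g`.

`SandwichHelpers.sandwich_dichotomy` records the POSITIVE horn of such a pair (blind on the negatives,
or acceptance pierced by one clause). This file records the DUAL horn and its consequence on the
referee pair, which is much stronger in effect:

* `card_filter_satTerm_rej_le` — if `R₀` is a monomial of `dnf`, every rejected negative with `R₀`
  entirely ON switches `dnf`, hence `cnf`, on, so it is charged to the negative error (`≤ ε·#N`);
* `dual_dichotomy` — hence a legal pair with the two error bounds forces: BLIND ON THE POSITIVES
  (`dnf = ∅`) or REJECTION PIERCED BY FEWER THAN `r` SLOTS;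
* `card_filter_not_satTerm_mul_le` / `card_negFilter_not_satTerm_mul_floor_le` — among the negatives of
  the referee pair (complements of the `t`-subsets of the `n` edge slots, `t = n / ⌊m^{1/8}⌋₊`) a fixed
  set of `< r` slots is NOT entirely on in at most `(r-1)·t/n ≤ (r-1)/⌊m^{1/8}⌋₊` of them;
* `horns_of_pair` — THE TWO HORNS: a sandwichable `g` accepts `≤ ε·#P` positives OR rejects
  `≤ (ε + (r-1)/⌊m^{1/8}⌋₊)·#N` negatives;
* `pair_of_blind` — conversely (cheap exits, cf. `SandwichHelpers.sandwich_cheap_exit`) a `g` blind on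
  one side at threshold `ε` has such a pair.

So every r7 leaf is bracketed between two clause-free statements that differ only by the slack
`(r-1)/⌊m^{1/8}⌋₊` in the rejection threshold: every wide gate of the class reading local CNFs of the
edges is ONE-SIDEDLY BLIND on (bare `⌈m^{1/4}⌉₊`-cliques, complements of `(#E/⌊m^{1/8}⌋₊)`-edge
graphs). A counterexample to a leaf is exactly one such gate that WEAKLY SEPARATES the pair (accepts
`> ε·#P` AND rejects `> (ε + (r-1)/⌊m^{1/8}⌋₊)·#N`); neither the pair `(dnf, cnf)` nor any clause
family has to be considered. Lead prover seat `prover-line-stmt-PneNP-10682-c10`, 2026-08-17.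
-/

set_option linter.dupNamespace false

open Literature.Computability.Complexity Filter Finset
open Summit.PneNP.PneNP.Theorems.CliqueExtLowerBound.WidthThreshold

noncomputable section

namespace Summit.PneNP.PneNP.Theorems.CliqueExtLowerBound.WidthThreshold.Horns

/-! ## §1 The dual horn of a legal pair (any slot type, any Boolean function `g`) -/

section Generic

variable {ι : Type}

open Classical in
/-- **Dual horn, pointwise.** If `R₀` is a monomial of the DNF of a legal pair whose CNF accepts at most
`ε · #N` rejected negatives, then at most `ε · #N` negatives are rejected with `R₀` entirely on: such a
negative switches the DNF on, hence the CNF. [folklore] -/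
theorem card_filter_satTerm_rej_le (g : (ι → Bool) → Bool) (N : Finset (ι → Bool)) (ε : ℝ)
    {dnf cnf : Finset (Finset ι)} (hle : ∀ x, EvalDNF dnf x → EvalCNF cnf x) {R₀ : Finset ι}
    (hR₀ : R₀ ∈ dnf) (hN : (#(N.filter fun x => EvalCNF cnf x ∧ g x = false) : ℝ) ≤ ε * #N) :
    (#(N.filter fun x => SatTerm R₀ x ∧ g x = false) : ℝ) ≤ ε * #N := by
  refine le_trans ?_ hN
  exact_mod_cast card_le_card fun x hx => by
    rw [mem_filter] at hx ⊢
    exact ⟨hx.1, hle x ⟨R₀, hR₀, hx.2.1⟩, hx.2.2⟩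

open Classical in
/-- **Positive blindness from an empty DNF.** If the DNF of a pair is empty (the constant `0`), its
positive error is the whole set of accepted positives. [folklore] -/
theorem card_filter_acc_le_of_dnf_empty (g : (ι → Bool) → Bool) (P : Finset (ι → Bool)) (ε : ℝ)
    (hP : (#(P.filter fun x => g x = true ∧ ¬ EvalDNF (∅ : Finset (Finset ι)) x) : ℝ) ≤ ε * #P) :
    (#(P.filter fun x => g x = true) : ℝ) ≤ ε * #P := by
  have : P.filter (fun x => g x = true ∧ ¬ EvalDNF (∅ : Finset (Finset ι)) x) =
      P.filter fun x => g x = true :=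
    filter_congr fun x _ => by simp
  rwa [this] at hP

open Classical in
/-- **Dual dichotomy (sandwichable ⇒ blind on the positives or rejection pierced by `< r` slots).**
If `g` has a legal pair with monomials of `< r` slots losing `≤ ε·#P` accepted positives and accepting
`≤ ε·#N` rejected negatives, then either `g` accepts at most `ε·#P` positives, or some set `R₀` of
fewer than `r` slots is such that at most `ε·#N` negatives are rejected with `R₀` entirely on.
(The clause family of the pair is not used.) [folklore] -/
theorem dual_dichotomy (g : (ι → Bool) → Bool) (P N : Finset (ι → Bool)) (ε : ℝ) {r s : ℕ}
    (h : ∃ dnf cnf : Finset (Finset ι), (∀ R ∈ dnf, #R ≤ r - 1) ∧ (∀ S ∈ cnf, #S ≤ s - 1) ∧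
      (∀ x, EvalDNF dnf x → EvalCNF cnf x) ∧
      (#(P.filter fun x => g x = true ∧ ¬ EvalDNF dnf x) : ℝ) ≤ ε * #P ∧
      (#(N.filter fun x => EvalCNF cnf x ∧ g x = false) : ℝ) ≤ ε * #N) :
    (#(P.filter fun x => g x = true) : ℝ) ≤ ε * #P ∨
      ∃ R₀ : Finset ι, #R₀ ≤ r - 1 ∧
        (#(N.filter fun x => SatTerm R₀ x ∧ g x = false) : ℝ) ≤ ε * #N := by
  obtain ⟨dnf, cnf, hr, -, hle, hP, hN⟩ := h
  rcases dnf.eq_empty_or_nonempty with rfl | ⟨R₀, hR₀⟩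
  · exact Or.inl (card_filter_acc_le_of_dnf_empty g P ε hP)
  · exact Or.inr ⟨R₀, hr R₀ hR₀, card_filter_satTerm_rej_le g N ε hle hR₀ hN⟩

open Classical in
/-- **Cheap exit, positive side** (the constant pair `(∅, {∅})`): a `g` accepting `≤ ε·#P` positives
has a legal pair with both errors `≤ ε` (`ε ≥ 0`), at every locality. [folklore] -/
theorem pair_of_pos_blind (g : (ι → Bool) → Bool) (P N : Finset (ι → Bool)) {ε : ℝ} (hε : 0 ≤ ε)
    (r s : ℕ) (hP : (#(P.filter fun x => g x = true) : ℝ) ≤ ε * #P) :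
    ∃ dnf cnf : Finset (Finset ι), (∀ R ∈ dnf, #R ≤ r - 1) ∧ (∀ S ∈ cnf, #S ≤ s - 1) ∧
      (∀ x, EvalDNF dnf x → EvalCNF cnf x) ∧
      (#(P.filter fun x => g x = true ∧ ¬ EvalDNF dnf x) : ℝ) ≤ ε * #P ∧
      (#(N.filter fun x => EvalCNF cnf x ∧ g x = false) : ℝ) ≤ ε * #N := by
  refine ⟨∅, {∅}, fun R hR => by simp at hR, fun S hS => by simp [mem_singleton.1 hS],
    fun x hx => absurd hx not_evalDNF_empty, ?_, ?_⟩
  · have : P.filter (fun x => g x = true ∧ ¬ EvalDNF (∅ : Finset (Finset ι)) x) =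
        P.filter fun x => g x = true :=
      filter_congr fun x _ => by simp
    rwa [this]
  · have : N.filter (fun x => EvalCNF ({∅} : Finset (Finset ι)) x ∧ g x = false) = ∅ :=
      filter_eq_empty_iff.2 fun x _ h => not_evalCNF_singleton_empty h.1
    rw [this, card_empty, Nat.cast_zero]
    positivity

open Classical in
/-- **Cheap exit, negative side** (the constant pair `({∅}, ∅)`): a `g` rejecting `≤ ε·#N` negatives
has a legal pair with both errors `≤ ε` (`ε ≥ 0`), at every locality. [folklore] -/
theorem pair_of_neg_blind (g : (ι → Bool) → Bool) (P N : Finset (ι → Bool)) {ε : ℝ} (hε : 0 ≤ ε)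
    (r s : ℕ) (hN : (#(N.filter fun x => g x = false) : ℝ) ≤ ε * #N) :
    ∃ dnf cnf : Finset (Finset ι), (∀ R ∈ dnf, #R ≤ r - 1) ∧ (∀ S ∈ cnf, #S ≤ s - 1) ∧
      (∀ x, EvalDNF dnf x → EvalCNF cnf x) ∧
      (#(P.filter fun x => g x = true ∧ ¬ EvalDNF dnf x) : ℝ) ≤ ε * #P ∧
      (#(N.filter fun x => EvalCNF cnf x ∧ g x = false) : ℝ) ≤ ε * #N := by
  refine ⟨{∅}, ∅, fun R hR => by simp [mem_singleton.1 hR], fun S hS => by simp at hS,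
    fun x _ => evalCNF_empty, ?_, ?_⟩
  · have : P.filter (fun x => g x = true ∧ ¬ EvalDNF ({∅} : Finset (Finset ι)) x) = ∅ :=
      filter_eq_empty_iff.2 fun x _ h => h.2 evalDNF_singleton_empty
    rw [this, card_empty, Nat.cast_zero]
    positivity
  · have : N.filter (fun x => EvalCNF (∅ : Finset (Finset ι)) x ∧ g x = false) =
        N.filter fun x => g x = false :=
      filter_congr fun x _ => by simp
    rwa [this]

open Classical in
/-- **One-sidedly blind ⇒ sandwichable** (both cheap exits). [folklore] -/
theorem pair_of_blind (g : (ι → Bool) → Bool) (P N : Finset (ι → Bool)) {ε : ℝ} (hε : 0 ≤ ε)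
    (r s : ℕ) (h : (#(P.filter fun x => g x = true) : ℝ) ≤ ε * #P ∨
      (#(N.filter fun x => g x = false) : ℝ) ≤ ε * #N) :
    ∃ dnf cnf : Finset (Finset ι), (∀ R ∈ dnf, #R ≤ r - 1) ∧ (∀ S ∈ cnf, #S ≤ s - 1) ∧
      (∀ x, EvalDNF dnf x → EvalCNF cnf x) ∧
      (#(P.filter fun x => g x = true ∧ ¬ EvalDNF dnf x) : ℝ) ≤ ε * #P ∧
      (#(N.filter fun x => EvalCNF cnf x ∧ g x = false) : ℝ) ≤ ε * #N := by
  rcases h with h | h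
  · exact pair_of_pos_blind g P N hε r s h
  · exact pair_of_neg_blind g P N hε r s h

end Generic

/-! ## §2 Counting: a fixed small monomial is on in almost all negatives -/

section NegCount

variable {α : Type} [Fintype α] [DecidableEq α]

omit [Fintype α] in
/-- On the vector "every slot on except those of `M`", the monomial `R₀` is on iff `R₀` avoids `M`.
[folklore] -/
theorem satTerm_offVec_iff (R₀ M : Finset α) :
    SatTerm R₀ (fun e => decide (e ∉ M)) ↔ ∀ e ∈ R₀, e ∉ M := by
  simp [SatTerm]

omit [Fintype α] in
/-- The coding `M ↦ (e ↦ [e ∉ M])` of the negatives is injective. [folklore] -/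
theorem offVec_injective : Function.Injective fun (M : Finset α) => fun e => decide (e ∉ M) := by
  intro M M' h
  ext e
  have h1 : decide (e ∉ M) = decide (e ∉ M') := congrFun h e
  by_cases he : e ∈ M <;> by_cases he' : e ∈ M' <;> simp [he, he'] at h1 ⊢

/-- The `t`-subsets of the slots meeting a fixed set `R₀` number at most `#R₀ · C(n-1, t-1)`.
[folklore] -/
theorem card_filter_meets_le (R₀ : Finset α) (t : ℕ) :
    #(((univ : Finset α).powersetCard t).filter fun M => ¬ ∀ e ∈ R₀, e ∉ M) ≤
      #R₀ * (Fintype.card α - 1).choose (t - 1) := by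
  calc #(((univ : Finset α).powersetCard t).filter fun M => ¬ ∀ e ∈ R₀, e ∉ M)
      ≤ #(R₀.biUnion fun e => ((univ : Finset α).powersetCard t).filter fun M => {e} ⊆ M) := by
        refine card_le_card fun M hM => ?_
        rw [mem_filter] at hM
        obtain ⟨hMt, hne⟩ := hM
        simp only [not_forall, not_not] at hne
        obtain ⟨e, heR, heM⟩ := hne
        exact mem_biUnion.2 ⟨e, heR, mem_filter.2 ⟨hMt, singleton_subset_iff.2 heM⟩⟩
    _ ≤ ∑ e ∈ R₀, #(((univ : Finset α).powersetCard t).filter fun M => {e} ⊆ M) := card_biUnion_le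
    _ ≤ ∑ e ∈ R₀, (Fintype.card α - 1).choose (t - 1) := by
        refine sum_le_sum fun e _ => ?_
        rcases Nat.eq_zero_or_pos t with rfl | ht
        · refine (card_le_card (filter_subset _ _)).trans ?_
          simp
        · rw [Negative.card_filter_supset {e} t (by rw [card_singleton]; exact ht), card_singleton]
    _ = #R₀ * (Fintype.card α - 1).choose (t - 1) := by rw [sum_const, smul_eq_mul]

open Classical in
/-- Among the negatives coded by the `t`-subsets of the `n` slots, a fixed monomial `R₀` is NOT entirely
on in at most a fraction `#R₀ · t / n` of them (cross-multiplied). [folklore] -/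
theorem card_filter_not_satTerm_mul_le (R₀ : Finset α) (t : ℕ) (ht : t ≤ Fintype.card α) :
    #((((univ : Finset α).powersetCard t).image fun M => fun e => decide (e ∉ M)).filter
        fun y => ¬ SatTerm R₀ y) * Fintype.card α ≤
      #R₀ * t * #(((univ : Finset α).powersetCard t).image fun M => fun e => decide (e ∉ M)) := by
  have hinj : Function.Injective fun (M : Finset α) => fun e => decide (e ∉ M) :=
    offVec_injective
  rw [filter_image, card_image_of_injective _ hinj, card_image_of_injective _ hinj,
    card_powersetCard, card_univ]
  rcases Nat.eq_zero_or_pos t with rfl | htpos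
  · simp [SatTerm]
  · calc #(((univ : Finset α).powersetCard t).filter fun M =>
            ¬ SatTerm R₀ (fun e => decide (e ∉ M))) * Fintype.card α
          = #(((univ : Finset α).powersetCard t).filter fun M => ¬ ∀ e ∈ R₀, e ∉ M) *
              Fintype.card α := by
            congr 2
            exact filter_congr fun M _ => by rw [satTerm_offVec_iff]
      _ ≤ #R₀ * (Fintype.card α - 1).choose (t - 1) * Fintype.card α :=
            Nat.mul_le_mul_right _ (card_filter_meets_le R₀ t)
      _ = #R₀ * ((Fintype.card α - 1).choose (t - 1) * Fintype.card α ^ 1) := by ring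
      _ ≤ #R₀ * ((Fintype.card α).choose t * t ^ 1) :=
            Nat.mul_le_mul_left _ (Negative.choose_sub_sub_mul_pow_le _ t ht 1 htpos)
      _ = #R₀ * t * (Fintype.card α).choose t := by ring

open Classical in
/-- The same for `t = n / D`: the bad fraction is at most `#R₀ / D` (cross-multiplied by `D`).
[folklore] -/
theorem card_filter_not_satTerm_mul_div_le (R₀ : Finset α) (D : ℕ) :
    #((((univ : Finset α).powersetCard (Fintype.card α / D)).image
          fun M => fun e => decide (e ∉ M)).filter fun y => ¬ SatTerm R₀ y) * D ≤
      #R₀ * #(((univ : Finset α).powersetCard (Fintype.card α / D)).image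
          fun M => fun e => decide (e ∉ M)) := by
  set n := Fintype.card α with hn
  rcases Nat.eq_zero_or_pos n with h0 | hpos
  · have hα : IsEmpty α := Fintype.card_eq_zero_iff.1 h0
    have hR : R₀ = ∅ := eq_empty_of_isEmpty R₀
    have : ((((univ : Finset α).powersetCard (n / D)).image
        fun M => fun e => decide (e ∉ M)).filter fun y => ¬ SatTerm R₀ y) = ∅ :=
      filter_eq_empty_iff.2 fun y _ h => h (by rw [hR]; intro e he; simp at he)
    rw [this, card_empty, zero_mul]
    exact Nat.zero_le _
  · have h := card_filter_not_satTerm_mul_le R₀ (n / D) (Nat.div_le_self n D)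
    have hkey : #((((univ : Finset α).powersetCard (n / D)).image
          fun M => fun e => decide (e ∉ M)).filter fun y => ¬ SatTerm R₀ y) * D * n ≤
        #R₀ * #(((univ : Finset α).powersetCard (n / D)).image
          fun M => fun e => decide (e ∉ M)) * n := by
      calc _ = #((((univ : Finset α).powersetCard (n / D)).image
            fun M => fun e => decide (e ∉ M)).filter fun y => ¬ SatTerm R₀ y) * n * D := by ring
        _ ≤ #R₀ * (n / D) * #(((univ : Finset α).powersetCard (n / D)).image
            fun M => fun e => decide (e ∉ M)) * D := Nat.mul_le_mul_right _ h
        _ = #R₀ * #(((univ : Finset α).powersetCard (n / D)).image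
            fun M => fun e => decide (e ∉ M)) * (n / D * D) := by ring
        _ ≤ _ := Nat.mul_le_mul_left _ (Nat.div_mul_le_self n D)
    exact Nat.le_of_mul_le_mul_right hkey hpos

end NegCount

/-! ## §3 The two horns on the referee pair -/

open Classical in
/-- **Rejection pierced by `< r` slots ⇒ nearly blind on the negatives.** On the negatives of the
referee pair (complements of the `(#E/⌊m^{1/8}⌋₊)`-edge graphs), if at most `ε·#N` negatives are
rejected with the monomial `R₀` (`#R₀ ≤ r-1`) entirely on, then at most
`(ε + (r-1)/⌊m^{1/8}⌋₊)·#N` negatives are rejected at all (`m ≥ 1`). [folklore] -/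
theorem card_filter_rej_le_of_pierced {m : ℕ} (hm : 1 ≤ m) (g : (EV m → Bool) → Bool) (ε : ℝ)
    {r : ℕ} {R₀ : Finset (EV m)} (hR₀ : #R₀ ≤ r - 1)
    (hN : (#((((powersetCard (Fintype.card (EV m) / ⌊(m : ℝ) ^ (1 / 8 : ℝ)⌋₊)
        (univ : Finset (EV m))).image (fun M => fun e => decide (e ∉ M)))).filter
          fun x => SatTerm R₀ x ∧ g x = false) : ℝ) ≤
      ε * #(((powersetCard (Fintype.card (EV m) / ⌊(m : ℝ) ^ (1 / 8 : ℝ)⌋₊)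
        (univ : Finset (EV m))).image (fun M => fun e => decide (e ∉ M))))) :
    (#((((powersetCard (Fintype.card (EV m) / ⌊(m : ℝ) ^ (1 / 8 : ℝ)⌋₊)
        (univ : Finset (EV m))).image (fun M => fun e => decide (e ∉ M)))).filter
          fun x => g x = false) : ℝ) ≤
      (ε + ((r - 1 : ℕ) : ℝ) / ⌊(m : ℝ) ^ (1 / 8 : ℝ)⌋₊) *
        #(((powersetCard (Fintype.card (EV m) / ⌊(m : ℝ) ^ (1 / 8 : ℝ)⌋₊)
          (univ : Finset (EV m))).image (fun M => fun e => decide (e ∉ M)))) := by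
  set N := ((powersetCard (Fintype.card (EV m) / ⌊(m : ℝ) ^ (1 / 8 : ℝ)⌋₊)
    (univ : Finset (EV m))).image (fun M => fun e => decide (e ∉ M))) with hNdef
  set D : ℕ := ⌊(m : ℝ) ^ (1 / 8 : ℝ)⌋₊ with hDdef
  have hD : 1 ≤ D := by
    rw [hDdef, Nat.one_le_floor_iff]
    exact Real.one_le_rpow (by exact_mod_cast hm) (by norm_num)
  have hDpos : (0 : ℝ) < D := by exact_mod_cast hD
  -- the negatives on which `R₀` is not entirely on: at most `#R₀ / D` of them
  have hcnt : #(N.filter fun y => ¬ SatTerm R₀ y) * D ≤ #R₀ * #N :=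
    card_filter_not_satTerm_mul_div_le R₀ D
  have hcntR : (#(N.filter fun y => ¬ SatTerm R₀ y) : ℝ) ≤ ((r - 1 : ℕ) : ℝ) / D * #N := by
    rw [div_mul_eq_mul_div, le_div_iff₀ hDpos]
    have h1 : (#(N.filter fun y => ¬ SatTerm R₀ y) : ℝ) * D ≤ #R₀ * #N := by exact_mod_cast hcnt
    refine h1.trans ?_
    have h2 : (#R₀ : ℝ) ≤ ((r - 1 : ℕ) : ℝ) := by exact_mod_cast hR₀
    exact mul_le_mul_of_nonneg_right h2 (Nat.cast_nonneg _)
  calc (#(N.filter fun x => g x = false) : ℝ)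
      ≤ #(N.filter fun x => SatTerm R₀ x ∧ g x = false) + #(N.filter fun y => ¬ SatTerm R₀ y) := by
        refine card_filter_le_add N _ _ _ fun x _ hx => ?_
        by_cases hs : SatTerm R₀ x
        · exact Or.inl ⟨hs, hx⟩
        · exact Or.inr hs
    _ ≤ ε * #N + ((r - 1 : ℕ) : ℝ) / D * #N := add_le_add hN hcntR
    _ = (ε + ((r - 1 : ℕ) : ℝ) / D) * #N := by ring

open Classical in
/-- **THE TWO HORNS (sandwichable ⇒ one-sidedly blind).** On the referee pair at `m ≥ 1`, for ANY Boolean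
function `g` of the edge slots (e.g. `g = φ ∘ cval C`, a wide gate reading local CNFs) and any family
`P` of positives: if a legal pair `dnf ≤ cnf` with monomials of `< r` slots loses `≤ ε·#P` of the
positives accepted by `g` and accepts `≤ ε·#N` of the negatives rejected by `g`, then `g` accepts
`≤ ε·#P` positives OR rejects `≤ (ε + (r-1)/⌊m^{1/8}⌋₊)·#N` negatives. The clause family, the clause
width `s` and the structure of `g` play no role. [folklore] -/
theorem horns_of_pair {m : ℕ} (hm : 1 ≤ m) (g : (EV m → Bool) → Bool) (P : Finset (EV m → Bool))
    (ε : ℝ) {r s : ℕ}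
    (h : ∃ dnf cnf : Finset (Finset (EV m)), (∀ R ∈ dnf, #R ≤ r - 1) ∧ (∀ S ∈ cnf, #S ≤ s - 1) ∧
      (∀ x, EvalDNF dnf x → EvalCNF cnf x) ∧
      (#(P.filter fun x => g x = true ∧ ¬ EvalDNF dnf x) : ℝ) ≤ ε * #P ∧
      (#((((powersetCard (Fintype.card (EV m) / ⌊(m : ℝ) ^ (1 / 8 : ℝ)⌋₊)
        (univ : Finset (EV m))).image (fun M => fun e => decide (e ∉ M)))).filter
          fun x => EvalCNF cnf x ∧ g x = false) : ℝ) ≤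
        ε * #(((powersetCard (Fintype.card (EV m) / ⌊(m : ℝ) ^ (1 / 8 : ℝ)⌋₊)
          (univ : Finset (EV m))).image (fun M => fun e => decide (e ∉ M))))) :
    (#(P.filter fun x => g x = true) : ℝ) ≤ ε * #P ∨
      (#((((powersetCard (Fintype.card (EV m) / ⌊(m : ℝ) ^ (1 / 8 : ℝ)⌋₊)
        (univ : Finset (EV m))).image (fun M => fun e => decide (e ∉ M)))).filter
          fun x => g x = false) : ℝ) ≤
        (ε + ((r - 1 : ℕ) : ℝ) / ⌊(m : ℝ) ^ (1 / 8 : ℝ)⌋₊) *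
          #(((powersetCard (Fintype.card (EV m) / ⌊(m : ℝ) ^ (1 / 8 : ℝ)⌋₊)
            (univ : Finset (EV m))).image (fun M => fun e => decide (e ∉ M)))) := by
  rcases dual_dichotomy g P _ ε h with hP | ⟨R₀, hR₀, hN⟩
  · exact Or.inl hP
  · exact Or.inr (card_filter_rej_le_of_pierced hm g ε hR₀ hN)

open Classical in
/-- **The bracket, lower half (one-sidedly blind at threshold `ε` ⇒ sandwichable)**, stated on the
referee pair in the vocabulary of the r7 leaves (`ε ≥ 0`). Together with `horns_of_pair`:
blind(`ε`) ⇒ r7-leaf conclusion ⇒ blind(`ε` on the positives | `ε + (r-1)/⌊m^{1/8}⌋₊` on the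
negatives). [folklore] -/
theorem pair_of_blind_referee {m : ℕ} (g : (EV m → Bool) → Bool) (P : Finset (EV m → Bool))
    {ε : ℝ} (hε : 0 ≤ ε) (r s : ℕ)
    (h : (#(P.filter fun x => g x = true) : ℝ) ≤ ε * #P ∨
      (#((((powersetCard (Fintype.card (EV m) / ⌊(m : ℝ) ^ (1 / 8 : ℝ)⌋₊)
        (univ : Finset (EV m))).image (fun M => fun e => decide (e ∉ M)))).filter
          fun x => g x = false) : ℝ) ≤
        ε * #(((powersetCard (Fintype.card (EV m) / ⌊(m : ℝ) ^ (1 / 8 : ℝ)⌋₊)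
          (univ : Finset (EV m))).image (fun M => fun e => decide (e ∉ M))))) :
    ∃ dnf cnf : Finset (Finset (EV m)), (∀ R ∈ dnf, #R ≤ r - 1) ∧ (∀ S ∈ cnf, #S ≤ s - 1) ∧
      (∀ x, EvalDNF dnf x → EvalCNF cnf x) ∧
      (#(P.filter fun x => g x = true ∧ ¬ EvalDNF dnf x) : ℝ) ≤ ε * #P ∧
      (#((((powersetCard (Fintype.card (EV m) / ⌊(m : ℝ) ^ (1 / 8 : ℝ)⌋₊)
        (univ : Finset (EV m))).image (fun M => fun e => decide (e ∉ M)))).filter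
          fun x => EvalCNF cnf x ∧ g x = false) : ℝ) ≤
        ε * #(((powersetCard (Fintype.card (EV m) / ⌊(m : ℝ) ^ (1 / 8 : ℝ)⌋₊)
          (univ : Finset (EV m))).image (fun M => fun e => decide (e ∉ M)))) :=
  pair_of_blind g P _ hε r s h

/-! ## §4 Registered binder-free forms -/

open Classical in
/-- REGISTERED SUB-GOAL of the line (binder-free form of `horns_of_pair`): **a sandwichable Boolean
function of the edge slots is one-sidedly blind on the referee pair** — accepts `≤ ε·#P` positives or
rejects `≤ (ε + (r-1)/⌊m^{1/8}⌋₊)·#N` negatives (`m ≥ 1`). [folklore] -/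
theorem horns_of_cnfPair : ∀ (m : ℕ), 1 ≤ m → ∀ (g : (EV m → Bool) → Bool)
    (P : Finset (EV m → Bool)) (ε : ℝ) (r s : ℕ),
    (∃ dnf cnf : Finset (Finset (EV m)), (∀ R ∈ dnf, #R ≤ r - 1) ∧ (∀ S ∈ cnf, #S ≤ s - 1) ∧
      (∀ x, EvalDNF dnf x → EvalCNF cnf x) ∧
      (#(P.filter fun x => g x = true ∧ ¬ EvalDNF dnf x) : ℝ) ≤ ε * #P ∧
      (#((((powersetCard (Fintype.card (EV m) / ⌊(m : ℝ) ^ (1 / 8 : ℝ)⌋₊)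
        (univ : Finset (EV m))).image (fun M => fun e => decide (e ∉ M)))).filter
          fun x => EvalCNF cnf x ∧ g x = false) : ℝ) ≤
        ε * #(((powersetCard (Fintype.card (EV m) / ⌊(m : ℝ) ^ (1 / 8 : ℝ)⌋₊)
          (univ : Finset (EV m))).image (fun M => fun e => decide (e ∉ M))))) →
    (#(P.filter fun x => g x = true) : ℝ) ≤ ε * #P ∨
      (#((((powersetCard (Fintype.card (EV m) / ⌊(m : ℝ) ^ (1 / 8 : ℝ)⌋₊)
        (univ : Finset (EV m))).image (fun M => fun e => decide (e ∉ M)))).filter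
          fun x => g x = false) : ℝ) ≤
        (ε + ((r - 1 : ℕ) : ℝ) / ⌊(m : ℝ) ^ (1 / 8 : ℝ)⌋₊) *
          #(((powersetCard (Fintype.card (EV m) / ⌊(m : ℝ) ^ (1 / 8 : ℝ)⌋₊)
            (univ : Finset (EV m))).image (fun M => fun e => decide (e ∉ M)))) :=
  fun _ hm g P ε _ _ h => horns_of_pair hm g P ε h

open Classical in
/-- REGISTERED SUB-GOAL of the line (binder-free form of `pair_of_blind_referee`): **a Boolean function of
the edge slots that is one-sidedly blind at threshold `ε ≥ 0` on the referee pair is sandwichable** at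
every locality (the constant pairs). [folklore] -/
theorem cnfPair_of_blind : ∀ (m : ℕ) (g : (EV m → Bool) → Bool) (P : Finset (EV m → Bool)) (ε : ℝ),
    0 ≤ ε → ∀ (r s : ℕ),
    ((#(P.filter fun x => g x = true) : ℝ) ≤ ε * #P ∨
      (#((((powersetCard (Fintype.card (EV m) / ⌊(m : ℝ) ^ (1 / 8 : ℝ)⌋₊)
        (univ : Finset (EV m))).image (fun M => fun e => decide (e ∉ M)))).filter
          fun x => g x = false) : ℝ) ≤
        ε * #(((powersetCard (Fintype.card (EV m) / ⌊(m : ℝ) ^ (1 / 8 : ℝ)⌋₊)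
          (univ : Finset (EV m))).image (fun M => fun e => decide (e ∉ M))))) →
    ∃ dnf cnf : Finset (Finset (EV m)), (∀ R ∈ dnf, #R ≤ r - 1) ∧ (∀ S ∈ cnf, #S ≤ s - 1) ∧
      (∀ x, EvalDNF dnf x → EvalCNF cnf x) ∧
      (#(P.filter fun x => g x = true ∧ ¬ EvalDNF dnf x) : ℝ) ≤ ε * #P ∧
      (#((((powersetCard (Fintype.card (EV m) / ⌊(m : ℝ) ^ (1 / 8 : ℝ)⌋₊)
        (univ : Finset (EV m))).image (fun M => fun e => decide (e ∉ M)))).filter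
          fun x => EvalCNF cnf x ∧ g x = false) : ℝ) ≤
        ε * #(((powersetCard (Fintype.card (EV m) / ⌊(m : ℝ) ^ (1 / 8 : ℝ)⌋₊)
          (univ : Finset (EV m))).image (fun M => fun e => decide (e ∉ M)))) :=
  fun _ g P _ hε r s h => pair_of_blind g P _ hε r s h

end Summit.PneNP.PneNP.Theorems.CliqueExtLowerBound.WidthThreshold.Horns

end
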